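import Literature.AlgebraicGeometry.Motives.FaltingsECEndCoreProofs
import Literature.NumberTheory.EllipticCurves.IsogenyQuotientCurveProofs
import Literature.NumberTheory.EllipticCurves.IsogenyClassFiniteProofs
import HarnessLib

/-!
# Faltings 1983, §5 for `E × E`: the subspace statement keyed to its two remaining inputs

Theorem-only `Proofs` companion of `Literature.AlgebraicGeometry.Motives.FaltingsECSubspaces`,
which vendors the named fact
`Literature.AlgebraicGeometry.Motives.stable_subspace_prod_eq_range W ℓ` — G. Faltings,
*Endlichkeitssätze für abelsche Varietäten über Zahlkörpern*, Invent. Math. 73 (1983), §5, the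
step "`W` is the image of an idempotent in `End_K(A) ⊗_ℤ ℚ_ℓ`" of the proof of Sätze 3–4 (Engl.
transl.: Cornell–Silverman, *Arithmetic Geometry*, Ch. II, §5, Theorems 3–4; held copy, PDF
pp. 89–90), for the abelian surface `A = E × E`: every `Γ_K`-stable `ℚ_ℓ`-subspace of
`V_ℓ E × V_ℓ E` is the image of an endomorphism `(a b; c d)` with entries in
`E_ℓ = image(End_K(E) ⊗ ℚ_ℓ → End(V_ℓ E))`.

The tree proves this fact from three named facts
(`stable_subspace_prod_eq_range_of_facts_of_core`, file `FaltingsECEndCoreProofs`: Satz 3 for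
`E` by Tate's argument on the quotients `E/G_n`, Satz 4 for `E` by linear algebra in the plane
`V_ℓ E`, and Sätze 3–4 for `E` give the subspace statement,
`stable_subspace_prod_eq_range_of_faltings`):

1. `WeierstrassCurve.finite_isogenyClass W` — Shafarevich's finiteness of the `K`-isomorphism
   classes in the `K`-isogeny class of `E` (Silverman, *AEC*, Cor. IX.6.2; the `g = 1` substitute
   for Faltings' Sätze 1–2), itself reduced in the tree to Shafarevich's Thm. IX.6.1
   (`WeierstrassCurve.finite_isogenyClass_of_shafarevich`) and to Siegel's theorem Cor. IX.3.2.1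
   (`WeierstrassCurve.finite_isogenyClass_of_siegel`);
2. `WeierstrassCurve.exists_separable_isogeny_ker_eq W` — the separable quotient isogeny
   `E → E/S` over `K` (*AEC* Prop. III.4.12), now a **theorem** of the tree
   (`WeierstrassCurve.exists_separable_isogeny_ker_eq_holds`, file
   `Literature.NumberTheory.EllipticCurves.IsogenyQuotientCurveProofs`);
3. `exists_eq_smul_one_of_equivariant_of_not_hasRationalCM W ℓ` — the residual core of Satz 4
   for `E` (`FaltingsECEndCore`): for `End_K(E) = ℤ` and `V_ℓ E` without `Γ_K`-stable line,
   `End_{Γ_K}(V_ℓ E) = ℚ_ℓ` (Faltings' theorem proper for non-CM curves; printed proofs through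
   the abelian surfaces `(E × E)/G_n` and Sätze 1–2, or Serre's local algebraicity).

This file records the consequence of (2) being proved: the subspace statement for `E × E` is
keyed to **two** named facts, in each of the three forms in which the tree states the first, and
— since conversely the subspace statement gives Satz 4 for `E`
(`mem_span_range_tateEndRingHom_iff_of_subspace_fact`) and Satz 4 gives the core
(`exists_eq_smul_one_of_equivariant_of_not_hasRationalCM_of_faltings`) — granted
`WeierstrassCurve.finite_isogenyClass W` the subspace statement is *equivalent* to the core fact.

## Contents (all proved; no definitions)

* `stable_subspace_prod_eq_range_of_finite_isogenyClass_of_core`: the named fact from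
  `WeierstrassCurve.finite_isogenyClass W` and the core fact.
* `stable_subspace_prod_eq_range_of_shafarevich_of_core`: from Shafarevich's Thm. IX.6.1 for `K`
  (`WeierstrassCurve.shafarevich_finite_goodReductionOutside K`) and the core fact.
* `stable_subspace_prod_eq_range_of_siegel_of_core`: from Siegel's theorem for `K`
  (`WeierstrassCurve.siegel_finite_integralPoints K`, *AEC* Cor. IX.3.2.1) and the core fact.
* `exists_eq_smul_one_of_equivariant_of_not_hasRationalCM_of_subspace_fact`: conversely, the
  subspace statement implies the core fact (unconditionally).
* `stable_subspace_prod_eq_range_iff_core_of_finite_isogenyClass`: granted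
  `WeierstrassCurve.finite_isogenyClass W`, the subspace statement and the core fact are
  equivalent.
* `stable_subspace_prod_eq_range_of_core`: the named fact from the core fact **alone** —
  Cor. IX.6.2 is now the tree's theorem `WeierstrassCurve.finite_isogenyClass_holds`, Shafarevich's
  Thm. IX.6.1 being `WeierstrassCurve.shafarevich_finite_goodReductionOutside_holds`
  (`ShafarevichGoodReductionProofs`, from Siegel's theorem assembled along *AEC* IX.§4: the unit
  equation after Beukers–Schlickewei / Bombieri–Gubler Thm. 5.2.1, Siegel's reduction Thm. IX.4.3,
  Cor. IX.4.3.1).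
* `stable_subspace_prod_eq_range_iff_core`: unconditionally, the subspace statement for `E × E`
  and the core fact are equivalent.

## Status of the discharge (tree, 2026-08-15)

`stable_subspace_prod_eq_range_holds` is `stable_subspace_prod_eq_range_of_core W ℓ` applied to a
discharge of `exists_eq_smul_one_of_equivariant_of_not_hasRationalCM W ℓ`, which is not in the
tree: by `stable_subspace_prod_eq_range_iff_core` the named fact now *is* the statement that for
an elliptic curve `E` over a number field with `End_K(E) = ℤ` and irreducible `V_ℓ E` the
commutant `End_{Γ_K}(V_ℓ E)` is `ℚ_ℓ` (equivalently, `ρ_ℓ(Γ_K)` is not abelian; Serre 1968,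
Ch. IV, 2.2). Shafarevich's finiteness of the isogeny class (input 1) and the separable quotient
isogeny (input 2) are theorems of the tree.

## References

* [Faltings1983Endlichkeit] G. Faltings, *Endlichkeitssätze für abelsche Varietäten über
  Zahlkörpern*, Invent. Math. 73 (1983), 349–366, §5, Sätze 3–4 and their proof; Engl. transl.
  in G. Cornell, J. H. Silverman (eds.), *Arithmetic Geometry*, Springer 1986, Ch. II, §5,
  Theorems 3–4 (held copy `book:cornellnd-arithmetic-geometry`, PDF pp. 89–90; read).
* [SilvermanAEC2009] J. H. Silverman, *The Arithmetic of Elliptic Curves*, 2nd ed., GTM 106: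
  Prop. III.4.12, Cor. IX.3.2.1, Thm. IX.6.1, Cor. IX.6.2.
* J.-P. Serre, *Abelian ℓ-adic representations and elliptic curves*, Benjamin 1968, Ch. IV §2.

## Design

Theorems only, no definitions, no instances; `noncomputable section`, one universe `u`,
`namespace Literature.AlgebraicGeometry.Motives`, base field `K : Type u` with the instance
hypotheses `[NumberField K] [W.IsElliptic]` inside the named facts, as in `FaltingsECSubspaces`.
Each theorem is a one-line composition of the tree's reductions. The file is a sibling rather
than an appendix to `FaltingsECSubspaces` because `FaltingsECEndCoreProofs` imports that file.
-/

noncomputable section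

universe u

namespace Literature.AlgebraicGeometry.Motives

open WeierstrassCurve

variable {K : Type u} [Field K] (W : WeierstrassCurve K) (ℓ : ℕ) [Fact ℓ.Prime]

/-- **The subspace statement for `E × E` from Shafarevich's finiteness of the isogeny class and
the core fact.** The named fact `stable_subspace_prod_eq_range W ℓ` (Faltings 1983, §5: every
`Γ_K`-stable `ℚ_ℓ`-subspace of `V_ℓ E × V_ℓ E` is the image of some `(a b; c d) ∈ M₂(E_ℓ)`, for
`E` elliptic over a number field `K`) follows from `WeierstrassCurve.finite_isogenyClass W`
(Silverman, *AEC*, Cor. IX.6.2) and `exists_eq_smul_one_of_equivariant_of_not_hasRationalCM W ℓ`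
(`FaltingsECEndCore`): this is the tree's `stable_subspace_prod_eq_range_of_facts_of_core` with
its third input, the separable quotient isogeny *AEC* Prop. III.4.12, discharged by
`WeierstrassCurve.exists_separable_isogeny_ker_eq_holds`.
[cite: Faltings1983Endlichkeit, §5, Sätze 3–4 (proof, transl. PDF pp. 89–90)] -/
theorem stable_subspace_prod_eq_range_of_finite_isogenyClass_of_core (hS : W.finite_isogenyClass)
    (hcore : exists_eq_smul_one_of_equivariant_of_not_hasRationalCM W ℓ) :
    stable_subspace_prod_eq_range W ℓ :=
  stable_subspace_prod_eq_range_of_facts_of_core W ℓ hS (exists_separable_isogeny_ker_eq_holds W)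
    hcore

/-- **The subspace statement for `E × E` from Shafarevich's Thm. IX.6.1 and the core fact.** The
named fact `stable_subspace_prod_eq_range W ℓ` follows from Shafarevich's theorem for the number
field `K` (`WeierstrassCurve.shafarevich_finite_goodReductionOutside K`, Silverman, *AEC*,
Thm. IX.6.1: finitely many `K`-isomorphism classes of elliptic curves over `K` with good reduction
outside a finite set of places) and `exists_eq_smul_one_of_equivariant_of_not_hasRationalCM W ℓ`,
Cor. IX.6.2 being the tree's `WeierstrassCurve.finite_isogenyClass_of_shafarevich` (with
Cor. VII.7.2, `WeierstrassCurve.IsIsogenous.badPlaces_eq_holds`).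
[cite: Faltings1983Endlichkeit, §5, Sätze 3–4 (proof, transl. PDF pp. 89–90)] -/
theorem stable_subspace_prod_eq_range_of_shafarevich_of_core
    (hSha : shafarevich_finite_goodReductionOutside K)
    (hcore : exists_eq_smul_one_of_equivariant_of_not_hasRationalCM W ℓ) :
    stable_subspace_prod_eq_range W ℓ :=
  stable_subspace_prod_eq_range_of_finite_isogenyClass_of_core W ℓ
    (finite_isogenyClass_of_shafarevich W hSha) hcore

/-- **The subspace statement for `E × E` from Siegel's theorem and the core fact.** The named fact
`stable_subspace_prod_eq_range W ℓ` follows from Siegel's finiteness of the `S`-integral points of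
elliptic curves over `K` (`WeierstrassCurve.siegel_finite_integralPoints K`, Silverman, *AEC*,
Cor. IX.3.2.1) and `exists_eq_smul_one_of_equivariant_of_not_hasRationalCM W ℓ`, Cor. IX.6.2
being the tree's `WeierstrassCurve.finite_isogenyClass_of_siegel` (Thm. IX.6.1 from Siegel's
theorem through the Mordell curves `y² = x³ + D`).
[cite: Faltings1983Endlichkeit, §5, Sätze 3–4 (proof, transl. PDF pp. 89–90)] -/
theorem stable_subspace_prod_eq_range_of_siegel_of_core (hSiegel : siegel_finite_integralPoints K)
    (hcore : exists_eq_smul_one_of_equivariant_of_not_hasRationalCM W ℓ) :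
    stable_subspace_prod_eq_range W ℓ :=
  stable_subspace_prod_eq_range_of_finite_isogenyClass_of_core W ℓ
    (finite_isogenyClass_of_siegel W hSiegel) hcore

/-- **The subspace statement for `E × E` implies the core fact.** Granted
`stable_subspace_prod_eq_range W ℓ`, every `Γ_K`-equivariant endomorphism of `V_ℓ E` is a scalar
when `End_K(E) = ℤ` (`exists_eq_smul_one_of_equivariant_of_not_hasRationalCM W ℓ`): the subspace
statement gives Satz 4 for `E` (`mem_span_range_tateEndRingHom_iff_of_subspace_fact`, through
Korollar 1 for `(E, E)`), and Satz 4 gives the core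
(`exists_eq_smul_one_of_equivariant_of_not_hasRationalCM_of_faltings`). No finiteness theorem is
used in this direction. [cite: Faltings1983Endlichkeit, §5, Satz 4 (proof)] -/
theorem exists_eq_smul_one_of_equivariant_of_not_hasRationalCM_of_subspace_fact
    (hX : stable_subspace_prod_eq_range W ℓ) :
    exists_eq_smul_one_of_equivariant_of_not_hasRationalCM W ℓ :=
  exists_eq_smul_one_of_equivariant_of_not_hasRationalCM_of_faltings W ℓ
    (mem_span_range_tateEndRingHom_iff_of_subspace_fact W ℓ hX)

/-- **Granted Shafarevich's finiteness of the isogeny class, the subspace statement for `E × E`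
is exactly the core fact.** For a Weierstrass curve `W` over `K` and a prime `ℓ`, if
`WeierstrassCurve.finite_isogenyClass W` holds (Silverman, *AEC*, Cor. IX.6.2), then
`stable_subspace_prod_eq_range W ℓ` (Faltings 1983, §5, for `A = E × E`) is equivalent to
`exists_eq_smul_one_of_equivariant_of_not_hasRationalCM W ℓ` (Satz 4 `⊗ ℚ_ℓ` for curves with
`End_K(E) = ℤ` and irreducible `V_ℓ E`): what remains of Faltings' theorem for `E × E` in the
tree is the non-abelianness of the `ℓ`-adic image for such curves.
[cite: Faltings1983Endlichkeit, §5, Sätze 3–4] -/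
theorem stable_subspace_prod_eq_range_iff_core_of_finite_isogenyClass
    (hS : W.finite_isogenyClass) :
    stable_subspace_prod_eq_range W ℓ ↔
      exists_eq_smul_one_of_equivariant_of_not_hasRationalCM W ℓ :=
  ⟨exists_eq_smul_one_of_equivariant_of_not_hasRationalCM_of_subspace_fact W ℓ,
    stable_subspace_prod_eq_range_of_finite_isogenyClass_of_core W ℓ hS⟩

/-- **The subspace statement for `E × E` from the core fact alone.** For a Weierstrass curve `W`
over `K` and a prime `ℓ`, the named fact `stable_subspace_prod_eq_range W ℓ` (Faltings 1983, §5,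
the step "`W` is the image of an idempotent in `End_K(A) ⊗ ℚ_ℓ`" for `A = E × E`: every
`Γ_K`-stable `ℚ_ℓ`-subspace of `V_ℓ E × V_ℓ E` is the image of some `(a b; c d) ∈ M₂(E_ℓ)`)
follows from the core fact `exists_eq_smul_one_of_equivariant_of_not_hasRationalCM W ℓ`
(`End_{Γ_K}(V_ℓ E) = ℚ_ℓ` for `End_K(E) = ℤ` and irreducible `V_ℓ E`) and nothing else: of the
three inputs of `stable_subspace_prod_eq_range_of_facts_of_core`, the separable quotient isogeny
(*AEC* III.4.12) is `WeierstrassCurve.exists_separable_isogeny_ker_eq_holds` and Shafarevich's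
finiteness of the `K`-isogeny class (*AEC* Cor. IX.6.2) is `WeierstrassCurve.finite_isogenyClass_holds`
(`IsogenyClassFiniteProofs`: `finite_isogenyClass_of_shafarevich` fed with the tree's theorem
`WeierstrassCurve.shafarevich_finite_goodReductionOutside_holds`, *AEC* Thm. IX.6.1, proved in
`ShafarevichGoodReductionProofs` from Siegel's theorem, itself assembled along *AEC* IX.§4 from the
finiteness of the unit equation). [cite: Faltings1983Endlichkeit, §5, Sätze 3–4 (proof, transl. PDF pp. 89–90)] -/
theorem stable_subspace_prod_eq_range_of_core
    (hcore : exists_eq_smul_one_of_equivariant_of_not_hasRationalCM W ℓ) :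
    stable_subspace_prod_eq_range W ℓ :=
  stable_subspace_prod_eq_range_of_finite_isogenyClass_of_core W ℓ (finite_isogenyClass_holds W)
    hcore

/-- **The subspace statement for `E × E` is exactly the core fact.** For a Weierstrass curve `W`
over `K` and a prime `ℓ`, `stable_subspace_prod_eq_range W ℓ` (Faltings 1983, §5, for
`A = E × E`) holds iff `exists_eq_smul_one_of_equivariant_of_not_hasRationalCM W ℓ` does (for `E`
elliptic over a number field with `End_K(E) = ℤ` and `V_ℓ E` without `Γ_K`-stable line, every
`Γ_K`-equivariant endomorphism of `V_ℓ E` is a scalar — equivalently the image of `Γ_K` in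
`GL(V_ℓ E)` is not abelian, Serre 1968, Ch. IV, 2.2). Direction `→` uses no finiteness theorem
(`exists_eq_smul_one_of_equivariant_of_not_hasRationalCM_of_subspace_fact`); direction `←` is
`stable_subspace_prod_eq_range_of_core` (Tate's argument on the quotients `E/G_n` with
Shafarevich's theorem, now proved, plus linear algebra in `V_ℓ E`). What remains of Faltings'
theorem for `E × E` in the tree is precisely this non-abelianness.
[cite: Faltings1983Endlichkeit, §5, Sätze 3–4] -/
theorem stable_subspace_prod_eq_range_iff_core :
    stable_subspace_prod_eq_range W ℓ ↔
      exists_eq_smul_one_of_equivariant_of_not_hasRationalCM W ℓ :=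
  ⟨exists_eq_smul_one_of_equivariant_of_not_hasRationalCM_of_subspace_fact W ℓ,
    stable_subspace_prod_eq_range_of_core W ℓ⟩

end Literature.AlgebraicGeometry.Motives

end
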